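import Summits.AnomalousDissipation.AnomalousDissipation.Theorems.EnsembleRigidityDefs
import Summits.AnomalousDissipation.AnomalousDissipation.Theorems.ImpulseGridGridThesisStubAcdcStrainBound
import Literature.Analysis.FluidPDE.StokesTorusProofs
import Literature.Analysis.FunctionSpaces.TorusCalculus
import Literature.Analysis.FunctionSpaces.TorusCalculusProofs
import Literature.Analysis.FunctionSpaces.TorusTestFunction

/-!
# Stub `stub_lambIdentity` of line `Sketch` (crux stmt-AnomalousDissipation-15509,
  `EnsembleRigidity.GPMeanBoundedFamily`)

The Lamb vector of the Galloway–Proctor force: for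
`f_GP(x) = sin(2πx₂)e₀ + sin(2πx₀)e₁ + sin(2πx₁)e₂` (`gpForce`) one has, pointwise on `T³`,
`(f_GP·∇)f_GP = 2π g` with the Lamb mode
`g = (sin2πx₁ cos2πx₂, sin2πx₂ cos2πx₀, sin2πx₀ cos2πx₁)` (`lambMode`, written as one half of a sum of
six Stokes sine modes by `sin a cos b = ½(sin(a+b) + sin(a−b))`).

Proof: `(f·∇)f = Df[f] = Σⱼ fⱼ ∂ⱼ f` (`Torus.fderiv_apply_eq_sum_partialDeriv`), the partial
derivatives of a sine Stokes mode are `∂ⱼ (Im e_k • a) = (2π kⱼ Re e_k) • a`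
(`AcdcStrain.partialDeriv_stokesMode_sin`, from `Torus.partialDeriv_mFourier`), and the characters are
multiplicative (`UnitAddTorus.mFourier_add`, `mFourier_neg`), so that
`Im e_{k+k'} + Im e_{k−k'} = 2 Im e_k Re e_{k'}`; the three components are then compared one by one.
-/

noncomputable section

-- every `Summit.AnomalousDissipation.AnomalousDissipation.…` name repeats the summit = sub-problem segment (D-0017 layout)
set_option linter.dupNamespace false

namespace Summit.AnomalousDissipation.AnomalousDissipation.Theorems.EnsembleRigidity.GPMeanBoundedFamily

open Literature.Analysis.FunctionSpaces Literature.Analysis.FluidPDE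
open Summit.AnomalousDissipation.AnomalousDissipation.Theorems.EnsembleRigidity

namespace StubLambIdentity

/-- A Stokes mode on `T³` is `C¹`. [folklore] -/
theorem isContDiff_one_stokesMode (k : Fin 3 → ℤ) (a : EuclideanSpace ℝ (Fin 3)) (c : Bool) :
    Torus.IsContDiff 1
      (⇑(Torus.stokesMode k a c) : UnitAddTorus (Fin 3) → EuclideanSpace ℝ (Fin 3)) :=
  (Torus.isSmooth_stokesMode k a c).isContDiff (by simp)

/-- `gpForce` is the sum of its three Stokes modes, as functions. [folklore] -/
theorem gpForce_eq_add :
    gpForce =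
      (⇑(Torus.stokesMode (Pi.single (2 : Fin 3) (1 : ℤ)) (EuclideanSpace.single (0 : Fin 3) (1 : ℝ)) false) :
          UnitAddTorus (Fin 3) → EuclideanSpace ℝ (Fin 3)) +
        ⇑(Torus.stokesMode (Pi.single (0 : Fin 3) (1 : ℤ)) (EuclideanSpace.single (1 : Fin 3) (1 : ℝ)) false) +
        ⇑(Torus.stokesMode (Pi.single (1 : Fin 3) (1 : ℤ)) (EuclideanSpace.single (2 : Fin 3) (1 : ℝ)) false) :=
  rfl

/-- `gpForce` is `C¹`. [folklore] -/
theorem isContDiff_one_gpForce : Torus.IsContDiff 1 gpForce := by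
  rw [gpForce_eq_add]
  exact ((isContDiff_one_stokesMode _ _ _).add (isContDiff_one_stokesMode _ _ _)).add
    (isContDiff_one_stokesMode _ _ _)

/-- The partial derivatives of the Galloway–Proctor force:
`∂ⱼ f_GP = 2π (δ_{j2} cos2πx₂ e₀ + δ_{j0} cos2πx₀ e₁ + δ_{j1} cos2πx₁ e₂)`. [folklore] -/
theorem partialDeriv_gpForce (j : Fin 3) (x : UnitAddTorus (Fin 3)) :
    Torus.partialDeriv j gpForce x =
      (2 * Real.pi * ((Pi.single (2 : Fin 3) (1 : ℤ) : Fin 3 → ℤ) j : ℝ) *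
            (UnitAddTorus.mFourier (Pi.single (2 : Fin 3) (1 : ℤ)) x).re) •
          EuclideanSpace.single (0 : Fin 3) (1 : ℝ) +
        (2 * Real.pi * ((Pi.single (0 : Fin 3) (1 : ℤ) : Fin 3 → ℤ) j : ℝ) *
            (UnitAddTorus.mFourier (Pi.single (0 : Fin 3) (1 : ℤ)) x).re) •
          EuclideanSpace.single (1 : Fin 3) (1 : ℝ) +
        (2 * Real.pi * ((Pi.single (1 : Fin 3) (1 : ℤ) : Fin 3 → ℤ) j : ℝ) *
            (UnitAddTorus.mFourier (Pi.single (1 : Fin 3) (1 : ℤ)) x).re) •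
          EuclideanSpace.single (2 : Fin 3) (1 : ℝ) := by
  rw [gpForce_eq_add,
    Torus.partialDeriv_add ((isContDiff_one_stokesMode _ _ _).add (isContDiff_one_stokesMode _ _ _))
      (isContDiff_one_stokesMode _ _ _),
    Torus.partialDeriv_add (isContDiff_one_stokesMode _ _ _) (isContDiff_one_stokesMode _ _ _)]
  simp only [Pi.add_apply, AcdcStrain.partialDeriv_stokesMode_sin]

/-- `(f_GP·∇)f_GP = Σⱼ (f_GP)ⱼ ∂ⱼ f_GP`. [folklore] -/
theorem convect_gpForce (x : UnitAddTorus (Fin 3)) :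
    Torus.convect gpForce gpForce x = ∑ j, gpForce x j • Torus.partialDeriv j gpForce x :=
  Torus.fderiv_apply_eq_sum_partialDeriv isContDiff_one_gpForce x (gpForce x)

/-- `e_{e₁+e₂} = e_{e₁} e_{e₂}`. [folklore] -/
theorem mFourier_011 (x : UnitAddTorus (Fin 3)) :
    UnitAddTorus.mFourier ![(0 : ℤ), 1, 1] x =
      UnitAddTorus.mFourier (Pi.single (1 : Fin 3) (1 : ℤ)) x *
        UnitAddTorus.mFourier (Pi.single (2 : Fin 3) (1 : ℤ)) x := by
  rw [← UnitAddTorus.mFourier_add]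
  congr 1

/-- `e_{e₁−e₂} = e_{e₁} conj e_{e₂}`. [folklore] -/
theorem mFourier_01m1 (x : UnitAddTorus (Fin 3)) :
    UnitAddTorus.mFourier ![(0 : ℤ), 1, -1] x =
      UnitAddTorus.mFourier (Pi.single (1 : Fin 3) (1 : ℤ)) x *
        (starRingEnd ℂ) (UnitAddTorus.mFourier (Pi.single (2 : Fin 3) (1 : ℤ)) x) := by
  rw [← UnitAddTorus.mFourier_neg, ← UnitAddTorus.mFourier_add]
  congr 1

/-- `e_{e₀+e₂} = e_{e₀} e_{e₂}`. [folklore] -/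
theorem mFourier_101 (x : UnitAddTorus (Fin 3)) :
    UnitAddTorus.mFourier ![(1 : ℤ), 0, 1] x =
      UnitAddTorus.mFourier (Pi.single (0 : Fin 3) (1 : ℤ)) x *
        UnitAddTorus.mFourier (Pi.single (2 : Fin 3) (1 : ℤ)) x := by
  rw [← UnitAddTorus.mFourier_add]
  congr 1

/-- `e_{−e₀+e₂} = conj e_{e₀} e_{e₂}`. [folklore] -/
theorem mFourier_m101 (x : UnitAddTorus (Fin 3)) :
    UnitAddTorus.mFourier ![(-1 : ℤ), 0, 1] x =
      (starRingEnd ℂ) (UnitAddTorus.mFourier (Pi.single (0 : Fin 3) (1 : ℤ)) x) *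
        UnitAddTorus.mFourier (Pi.single (2 : Fin 3) (1 : ℤ)) x := by
  rw [← UnitAddTorus.mFourier_neg, ← UnitAddTorus.mFourier_add]
  congr 1

/-- `e_{e₀+e₁} = e_{e₀} e_{e₁}`. [folklore] -/
theorem mFourier_110 (x : UnitAddTorus (Fin 3)) :
    UnitAddTorus.mFourier ![(1 : ℤ), 1, 0] x =
      UnitAddTorus.mFourier (Pi.single (0 : Fin 3) (1 : ℤ)) x *
        UnitAddTorus.mFourier (Pi.single (1 : Fin 3) (1 : ℤ)) x := by
  rw [← UnitAddTorus.mFourier_add]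
  congr 1

/-- `e_{e₀−e₁} = e_{e₀} conj e_{e₁}`. [folklore] -/
theorem mFourier_1m10 (x : UnitAddTorus (Fin 3)) :
    UnitAddTorus.mFourier ![(1 : ℤ), -1, 0] x =
      UnitAddTorus.mFourier (Pi.single (0 : Fin 3) (1 : ℤ)) x *
        (starRingEnd ℂ) (UnitAddTorus.mFourier (Pi.single (1 : Fin 3) (1 : ℤ)) x) := by
  rw [← UnitAddTorus.mFourier_neg, ← UnitAddTorus.mFourier_add]
  congr 1

end StubLambIdentity

/-- **Stub `stub_lambIdentity` of crux `GPMeanBoundedFamily`, line `Sketch`.** The Lamb vector of the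
Galloway–Proctor force: `(f_GP·∇)f_GP = 2π g` pointwise on `T³`, where
`f_GP = (sin 2πx₂, sin 2πx₀, sin 2πx₁)` and `g = (sin2πx₁ cos2πx₂, sin2πx₂ cos2πx₀, sin2πx₀ cos2πx₁)`
(product rule on the three sine modes, `Torus.fderiv_apply_eq_sum_partialDeriv`,
`Torus.partialDeriv_mFourier`, and `sin a cos b = ½(sin(a+b)+sin(a−b))` via `UnitAddTorus.mFourier_add`,
`mFourier_neg`). [folklore] -/
theorem stub_lambIdentity :
    ∀ x : UnitAddTorus (Fin 3), Torus.convect gpForce gpForce x = (2 * Real.pi) • lambMode x := by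
  intro x
  rw [StubLambIdentity.convect_gpForce]
  simp only [Fin.sum_univ_three, StubLambIdentity.partialDeriv_gpForce]
  -- the three characters `Eⱼ = e_{eⱼ}(x) = exp(2πi xⱼ)`
  have hg : ∀ j : Fin 3, gpForce x j =
      (UnitAddTorus.mFourier (Pi.single (2 : Fin 3) (1 : ℤ)) x).im * (if j = 0 then 1 else 0) +
      (UnitAddTorus.mFourier (Pi.single (0 : Fin 3) (1 : ℤ)) x).im * (if j = 1 then 1 else 0) +
      (UnitAddTorus.mFourier (Pi.single (1 : Fin 3) (1 : ℤ)) x).im * (if j = 2 then 1 else 0) := by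
    intro j
    simp [gpForce, Torus.stokesMode_apply]
  have hl : ∀ i : Fin 3, lambMode x i = (1 / 2 : ℝ) *
      (((UnitAddTorus.mFourier ![(0 : ℤ), 1, 1] x).im + (UnitAddTorus.mFourier ![(0 : ℤ), 1, -1] x).im) *
          (if i = 0 then 1 else 0) +
        ((UnitAddTorus.mFourier ![(1 : ℤ), 0, 1] x).im + (UnitAddTorus.mFourier ![(-1 : ℤ), 0, 1] x).im) *
          (if i = 1 then 1 else 0) +
        ((UnitAddTorus.mFourier ![(1 : ℤ), 1, 0] x).im + (UnitAddTorus.mFourier ![(1 : ℤ), -1, 0] x).im) *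
          (if i = 2 then 1 else 0)) := by
    intro i
    simp only [lambMode, Torus.stokesMode_apply, Bool.false_eq_true, if_false, PiLp.smul_apply,
      PiLp.add_apply, PiLp.single_apply, smul_eq_mul]
    ring
  ext i
  simp only [PiLp.add_apply, PiLp.smul_apply, PiLp.single_apply, smul_eq_mul, hg, hl,
    StubLambIdentity.mFourier_011, StubLambIdentity.mFourier_01m1, StubLambIdentity.mFourier_101,
    StubLambIdentity.mFourier_m101, StubLambIdentity.mFourier_110, StubLambIdentity.mFourier_1m10,
    Complex.mul_im, Complex.conj_re, Complex.conj_im]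
  fin_cases i <;> simp <;> ring

end Summit.AnomalousDissipation.AnomalousDissipation.Theorems.EnsembleRigidity.GPMeanBoundedFamily

end
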